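import Summits.Schanuel.Schanuel.Theorems.SoloInformedX193WellFormed

/-!
# X193 kernel, layer B (F11b): the finiteness law (FIN) is a consequence of (WF)

Solo-informed Schanuel programme, X193 kernel (DESIGN `work/s213/X193-KERNEL-DESIGN.md`,
Amendment A12 (iii), file F11b).  The law (FIN) of `SoloServiceData`
(`SoloInformedX193Service`): *the pieces alive at any fixed level have uniformly bounded
banks*, holds for EVERY abstract service structure satisfying (WF) with some constant `c₀`:
by the fourth conjunct of (WF) a column that is not near a root has bank `≤ c₀ g_P`, and by
the fifth conjunct every finite set of near-root columns of `P` has at most `g_P` elements,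
so the near-root columns of `P` form a finite set; hence the banks of one piece are bounded
(`SoloServiceData.exists_bank_le_of_wellFormed`), and the pieces alive at a level form a
`Finset` (`SoloServiceData.finiteLaw_of_wellFormed`).  In particular (F9a,
`soloX_pieces_wellFormed`) the pieces of an enemy sequence satisfy (FIN) for every `ξ ≠ 0`
(`soloX_pieces_finiteLaw`) — unconditionally and without transcendence.  No definitions.
-/

namespace Summit.Schanuel.Schanuel.Theorems

namespace SoloServiceData

variable {ι : Type*} (D : SoloServiceData ι)

/-- Under (WF) the near-root columns of a piece form a finite set (every finite subset has
at most `g_P` elements). -/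
theorem nearRoot_finite_of_wellFormed {c₀ : ℝ} (hW : D ∈ wellFormed c₀) (P : ι) :
    {k : ℕ | D.nearRoot P k = true}.Finite := by
  by_contra hinf
  obtain ⟨t, ht, hcard⟩ := Set.Infinite.exists_subset_card_eq hinf (D.deg P + 1)
  have hle : t.card ≤ D.deg P :=
    hW.2.2.2.2 P t fun k hk => ht (Finset.mem_coe.mpr hk)
  omega

/-- Under (WF) the banks of one piece are bounded above: by `|c₀ g_P|` off the near-root
columns, and by the finitely many near-root banks otherwise. -/
theorem exists_bank_le_of_wellFormed {c₀ : ℝ} (hW : D ∈ wellFormed c₀) (P : ι) :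
    ∃ B : ℝ, ∀ k : ℕ, D.bank P k ≤ B := by
  set T := (D.nearRoot_finite_of_wellFormed hW P).toFinset with hT
  refine ⟨|c₀ * D.deg P| + ∑ k ∈ T, |D.bank P k|, fun k => ?_⟩
  have hsum : 0 ≤ ∑ k ∈ T, |D.bank P k| := Finset.sum_nonneg fun k _ => abs_nonneg _
  have habs : 0 ≤ |c₀ * D.deg P| := abs_nonneg _
  cases hnr : D.nearRoot P k with
  | false =>
    have h1 : D.bank P k ≤ c₀ * D.deg P := hW.2.2.2.1 P k hnr
    have h2 : c₀ * D.deg P ≤ |c₀ * D.deg P| := le_abs_self _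
    linarith
  | true =>
    have hk : k ∈ T := by
      rw [hT, Set.Finite.mem_toFinset]
      exact hnr
    have h1 : |D.bank P k| ≤ ∑ k ∈ T, |D.bank P k| :=
      Finset.single_le_sum (fun k _ => abs_nonneg (D.bank P k)) hk
    have h2 : D.bank P k ≤ |D.bank P k| := le_abs_self _
    linarith

/-- **(FIN) from (WF).**  Every abstract service structure satisfying (WF) with some
constant satisfies the finiteness law: the pieces alive at a fixed level `m₀` form a finite
set and each has bounded banks. -/
theorem finiteLaw_of_wellFormed {c₀ : ℝ} (hW : D ∈ wellFormed c₀) : D ∈ finiteLaw := by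
  intro m₀
  choose B hB using fun P => D.exists_bank_le_of_wellFormed hW P
  refine ⟨∑ P ∈ D.alive m₀, |B P|, fun P hP k _ => ?_⟩
  have h1 : |B P| ≤ ∑ P ∈ D.alive m₀, |B P| :=
    Finset.single_le_sum (fun P _ => abs_nonneg (B P)) hP
  have h2 : B P ≤ |B P| := le_abs_self _
  exact (hB P k).trans (h2.trans h1)

end SoloServiceData

/-- **(FIN) for the pieces of an enemy sequence.**  For `ξ ≠ 0` and any sequence `R`, the
structure `soloX_pieces ξ R` satisfies the finiteness law (from `soloX_pieces_wellFormed`,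
unconditionally). -/
theorem soloX_pieces_finiteLaw {ξ : ℂ} (hξ : ξ ≠ 0) (R : ℕ → Polynomial ℤ) :
    soloX_pieces ξ R ∈ SoloServiceData.finiteLaw :=
  (soloX_pieces ξ R).finiteLaw_of_wellFormed (soloX_pieces_wellFormed hξ R)

end Summit.Schanuel.Schanuel.Theorems
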